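import Mathlib

/-!
# Coboundary ∕ Lyapunov COSTUME PROBE — idea-5 g5 (lens obstruction-first), barrier note BN-J, crux K2⁷ `stmt-QuantumFields-20543`
# (`Summit.QuantumFields.YangMills.Theses.BalabanUVNodes.EndpointGivenBR13SepCoPH`)

HONEST FRAMING: elementary real-sequence bookkeeping (Mathlib only); proves NOTHING of Bałaban ([I] Thm 2 ∕ (0.31) unproved in print);
K2⁷ is OPEN; the Yang–Mills mass gap (Clay) is NOT proved; route R4 `BalabanUVNodes` closes only the conditional finite-𝕋⁴ rung `BalabanLadder.UV`.

WHAT IS CERTIFIED (kernel, both directions).  For a real sequence `R` — read: the run remainder `R k = β k (prefixOf gs k) − c·b k` along ONE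
in-window run of (0.20), extended by `0` past the horizon — and reals `s` (slope defect per step) and `M` (total budget):

* (A) «LYAPUNOV ∕ DISSIPATION LETTER»  `∃ Q : ℕ → ℝ, (∀ k, 0 ≤ Q k ≤ M) ∧ ∀ k, Q (k+1) − Q k − s ≤ R k`
      (a bounded non-negative functional of the history whose DECREASE absorbs the negative part of the remainder, up to `s` per step);
* (B) «ONE-SIDED WINDOWED CESÀRO LETTER» `0 ≤ M ∧ ∀ j ≤ k, −M − s·(k − j) ≤ Σ_{i ∈ [j,k)} R i`
      (= the run-wise (PS)-type floor of record with a slope defect: tree shapes `BalabanUVNodesK2NamedJetsRunRemAt.runwisePS_of_drift_runConstRemainder`,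
       `Gaps.EndSurvivorCensus.endpointExistence_of_survivorLetters_runwisePS`),

`lyapunovLetter_iff_windowedCesaro : (A) ↔ (B)` (same `M`, same `s`; the witness for (B) ⇒ (A) is `Q := M − drawdown`, the running draw-down of `R + s`).

CONSEQUENCE (the barrier note BN-J, sequence half): a «monotone ∕ Lyapunov quantity» for NODE O typed on the β-HISTORY ALONE is exactly as strong as the
one-sided run-wise Cesàro floor it telescopes to — it is a COSTUME of the (PS) road (CRIT-1's standard, cf. `SignMarginCostume.signMarginLaw_iff_eventualPos`),
not a new supplier.  A Lyapunov functional with content must be typed on the STATE of the step map (the irrelevant coordinates of the effective action),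
where it IS the per-step contraction of [II] (0.31) ∕ a Brydges–Slade `‖K‖`-norm — i.e. it presupposes the R-operation extraction (the wall).  See
`FOUND-NOTHING-idea5-g5.md` §2 (Δ) and §4 BN-J.
-/

namespace Summit.QuantumFields.YangMills.Cruxes.EndpointGivenBR13SepCoPH.Idea5g5CoboundaryProbe

open Finset
open scoped BigOperators

/-- (A) the LYAPUNOV ∕ dissipation letter on a remainder sequence `R` with per-step defect `s` and budget `M`. [folklore] -/
def LyapunovLetter (R : ℕ → ℝ) (s M : ℝ) : Prop :=
  ∃ Q : ℕ → ℝ, (∀ k, 0 ≤ Q k ∧ Q k ≤ M) ∧ ∀ k, Q (k + 1) - Q k - s ≤ R k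

/-- (B) the ONE-SIDED WINDOWED CESÀRO letter (run-wise (PS)-type floor with slope defect `s`, budget `M`). [folklore] -/
def WindowedCesaroLetter (R : ℕ → ℝ) (s M : ℝ) : Prop :=
  0 ≤ M ∧ ∀ j k : ℕ, j ≤ k → -M - s * ((k : ℝ) - j) ≤ ∑ i ∈ Ico j k, R i

/-- The running DRAW-DOWN of `R + s`: `D₀ = 0`, `D_{k+1} = max (D_k − R_k − s) 0`. [folklore] -/
def drawdown (R : ℕ → ℝ) (s : ℝ) : ℕ → ℝ
  | 0 => 0
  | k + 1 => max (drawdown R s k - R k - s) 0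

theorem drawdown_nonneg (R : ℕ → ℝ) (s : ℝ) : ∀ k, 0 ≤ drawdown R s k
  | 0 => le_rfl
  | _ + 1 => le_max_right _ _

theorem drawdown_succ_ge (R : ℕ → ℝ) (s : ℝ) (k : ℕ) : drawdown R s k - R k - s ≤ drawdown R s (k + 1) :=
  le_max_left _ _

/-- The draw-down is attained on a window ending at `k`: `D_k = −Σ_{[j,k)} R − s·(k − j)` for some `j ≤ k`. [folklore] -/
theorem drawdown_witness (R : ℕ → ℝ) (s : ℝ) :
    ∀ k, ∃ j, j ≤ k ∧ drawdown R s k = -(∑ i ∈ Ico j k, R i) - s * ((k : ℝ) - j)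
  | 0 => ⟨0, le_rfl, by simp [drawdown]⟩
  | k + 1 => by
      by_cases h : drawdown R s k - R k - s ≤ 0
      · exact ⟨k + 1, le_rfl, by simp [drawdown, max_eq_right h]⟩
      · obtain ⟨j, hjk, hj⟩ := drawdown_witness R s k
        refine ⟨j, hjk.trans (Nat.le_succ k), ?_⟩
        show max (drawdown R s k - R k - s) 0 = _
        rw [max_eq_left (le_of_lt (not_le.mp h)), hj, Finset.sum_Ico_succ_top hjk]
        push_cast
        ring

/-- (A) ⇒ (B): telescoping. [folklore] -/
theorem windowedCesaro_of_lyapunov {R : ℕ → ℝ} {s M : ℝ} (h : LyapunovLetter R s M) : WindowedCesaroLetter R s M := by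
  obtain ⟨Q, hQ, hR⟩ := h
  refine ⟨(hQ 0).1.trans (hQ 0).2, fun j k hjk => ?_⟩
  have key : ∀ k, j ≤ k → Q k - Q j - s * ((k : ℝ) - j) ≤ ∑ i ∈ Ico j k, R i := by
    intro k hk
    induction k, hk using Nat.le_induction with
    | base => simp
    | succ k hk ih =>
        rw [Finset.sum_Ico_succ_top hk]
        have hk' := hR k
        push_cast
        linarith
  have h1 := key k hjk
  have h2 := (hQ k).1
  have h3 := (hQ j).2
  linarith

/-- (B) ⇒ (A): the witness is `Q := M − drawdown`. [folklore] -/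
theorem lyapunov_of_windowedCesaro {R : ℕ → ℝ} {s M : ℝ} (h : WindowedCesaroLetter R s M) : LyapunovLetter R s M := by
  obtain ⟨hM, hW⟩ := h
  refine ⟨fun k => M - drawdown R s k, fun k => ⟨?_, ?_⟩, fun k => ?_⟩
  · obtain ⟨j, hjk, hj⟩ := drawdown_witness R s k
    have := hW j k hjk
    linarith
  · have := drawdown_nonneg R s k
    linarith
  · have := drawdown_succ_ge R s k
    show (M - drawdown R s (k + 1)) - (M - drawdown R s k) - s ≤ R k
    linarith

/-- **★ THE COSTUME EQUIVALENCE**: the Lyapunov ∕ dissipation letter (A) and the one-sided windowed Cesàro floor (B) are the SAME statement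
(same budget `M`, same slope defect `s`). [folklore] -/
theorem lyapunovLetter_iff_windowedCesaro {R : ℕ → ℝ} {s M : ℝ} : LyapunovLetter R s M ↔ WindowedCesaroLetter R s M :=
  ⟨windowedCesaro_of_lyapunov, lyapunov_of_windowedCesaro⟩

/-- Reading aid: with NO slope defect (`s = 0`) the Cesàro side is the plain one-sided partial-sum floor `−M ≤ Σ_{[j,k)} R`, i.e. the tree's run-wise (PS) shape
verbatim (per run, per window). [folklore] -/
theorem lyapunovLetter_zero_iff {R : ℕ → ℝ} {M : ℝ} :
    LyapunovLetter R 0 M ↔ 0 ≤ M ∧ ∀ j k : ℕ, j ≤ k → -M ≤ ∑ i ∈ Ico j k, R i := by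
  rw [lyapunovLetter_iff_windowedCesaro, WindowedCesaroLetter]
  simp

end Summit.QuantumFields.YangMills.Cruxes.EndpointGivenBR13SepCoPH.Idea5g5CoboundaryProbe
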